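import Literature.AlgebraicGeometry.Motives.SmoothSpread
import Literature.AlgebraicGeometry.Motives.VarietiesRegularProofs
import Literature.AlgebraicGeometry.Resolution.RegularLocalRingsProofs
import HarnessLib

/-!
# Schemes smooth over a field have regular local rings (Stacks 056S; Görtz–Wedhorn 6.26)

Topic: `Literature/AlgebraicGeometry/Resolution`. The Stacks Project, Tag 056S (Lemma 33.25.3):
"Let `X → Spec(k)` be a smooth morphism where `k` is a field. Then `X` is a regular scheme."
PROVED here for Mathlib's `Smooth` and `IsRegularLocalRing`, from the tree's affine form
`Literature.AlgebraicGeometry.Motives.isRegularLocalRing_of_isStandardSmoothOfRelativeDimension`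
(standard smooth algebras over a field have regular localisations: étale over a polynomial ring)
and the standard-smooth charts at points of the smooth locus
(`Literature.AlgebraicGeometry.Motives.exists_appLE_isStandardSmoothOfRelativeDimension_of_mem_smoothLocus`);
the version `isRegularLocalRing_stalk_of_smoothOfRelativeDimension` of
`Motives/VarietiesRegularProofs.lean` assumes a fixed relative dimension, and the relative form
`isRegularLocalRing_stalk_of_smooth` of `AlterationsLemma32.lean` (EGA IV₄ 17.5.8 (iii): smooth
over a regular locally Noetherian base) gives this too, over the field `K`; the direct chart proof
here keeps the imports to the two Motives files. Consequences recorded: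
the local rings are domains (`isDomain_of_isRegularLocalRing`, `RegularLocalRingsProofs.lean`),
and `X` is reduced. (Bookkeeping for de Jong 1996, 4.22: the
generic fibre of the semi-stable curve `𝒞 → Y`, smooth over `Y ∖ D`, is a regular curve.)

## Sources

* The Stacks Project, Tag 056S (Lemma 33.25.3).
* U. Görtz, T. Wedhorn, *Algebraic Geometry I*, 2nd ed. (2020), Lemma 6.26 (p. 196).
-/

noncomputable section

open CategoryTheory AlgebraicGeometry TopologicalSpace

namespace Literature.AlgebraicGeometry.Resolution

universe u

variable {K : Type u} [Field K] {X : Scheme.{u}} (f : X ⟶ Spec (CommRingCat.of K))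

/-- **Charts of a smooth scheme over a field**: if `f : X → Spec K` is smooth, every point has an
affine open neighbourhood `V` with a ring map `K → Γ(X, V)` standard smooth of some relative
dimension `d` (the chart `Γ(Spec K, U) → Γ(X, V)` at a point of the smooth locus, `U = Spec K`,
composed with `K ≅ Γ(Spec K, ⊤)`). [folklore] -/
theorem exists_isStandardSmoothOfRelativeDimension_of_smooth [Smooth f] (x : X) :
    ∃ (d : ℕ) (V : X.Opens) (_ : IsAffineOpen V) (_ : x ∈ V) (φ : K →+* Γ(X, V)),
      φ.IsStandardSmoothOfRelativeDimension d := by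
  have hx : x ∈ f.smoothLocus := by
    rw [Scheme.Hom.smoothLocus_eq_top]
    trivial
  obtain ⟨d, ⟨U, hU⟩, ⟨V, hV⟩, hxV, e, hstd⟩ :=
    Literature.AlgebraicGeometry.Motives.exists_appLE_isStandardSmoothOfRelativeDimension_of_mem_smoothLocus
      f hx
  have hUtop : U = ⊤ := by
    ext y
    simp only [Opens.coe_top, Set.mem_univ, iff_true]
    have : f x ∈ U := e hxV
    rwa [Subsingleton.elim y (f x)]
  subst hUtop
  refine ⟨d, V, hV, hxV, (f.appLE ⊤ V e).hom.comp
    (Scheme.ΓSpecIso (CommRingCat.of K)).commRingCatIsoToRingEquiv.symm.toRingHom, ?_⟩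
  exact RingHom.isStandardSmoothOfRelativeDimension_respectsIso.2 _ _ hstd

/-- **Stacks 056S: a scheme smooth over a field is regular** — every local ring `𝒪_{X,x}` of a
smooth `K`-scheme `X` is a regular local ring: it is the localisation at a prime of a chart
`Γ(X, V)` standard smooth over `K`, which is étale over a polynomial ring
(`Literature.AlgebraicGeometry.Motives.isRegularLocalRing_of_isStandardSmoothOfRelativeDimension`).
[cite: StacksProject, Tag 056S (Lemma 33.25.3)] -/
theorem isRegularLocalRing_stalk_of_smooth_of_field [Smooth f] (x : X) :
    IsRegularLocalRing (X.presheaf.stalk x) := by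
  obtain ⟨d, V, hV, hxV, φ, hφ⟩ := exists_isStandardSmoothOfRelativeDimension_of_smooth f x
  algebraize [φ]
  letI : Algebra Γ(X, V) (X.presheaf.stalk x) :=
    TopCat.Presheaf.algebra_section_stalk X.presheaf ⟨x, hxV⟩
  have hloc : IsLocalization.AtPrime (X.presheaf.stalk x) (hV.primeIdealOf ⟨x, hxV⟩).asIdeal :=
    hV.isLocalization_stalk ⟨x, hxV⟩
  let P := (hV.primeIdealOf ⟨x, hxV⟩).asIdeal
  haveI := Literature.AlgebraicGeometry.Motives.isRegularLocalRing_of_isStandardSmoothOfRelativeDimension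
    K d P
  exact IsRegularLocalRing.of_ringEquiv
    (IsLocalization.algEquiv P.primeCompl (Localization.AtPrime P) (X.presheaf.stalk x)).toRingEquiv

/-- The local rings of a scheme smooth over a field are domains. [folklore] -/
theorem isDomain_stalk_of_smooth [Smooth f] (x : X) : IsDomain (X.presheaf.stalk x) :=
  haveI := isRegularLocalRing_stalk_of_smooth_of_field f x
  isDomain_of_isRegularLocalRing (X.presheaf.stalk x)

/-- A scheme smooth over a field is reduced (its local rings are domains). [folklore] -/
theorem isReduced_of_smooth [Smooth f] : IsReduced X :=
  haveI : ∀ x : X, _root_.IsReduced (X.presheaf.stalk x) := fun x =>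
    haveI := isDomain_stalk_of_smooth f x
    inferInstance
  isReduced_of_isReduced_stalk X

end Literature.AlgebraicGeometry.Resolution

end
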